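import Summits.BirchSwinnertonDyer.BirchSwinnertonDyer.Theorems.PrintCf2RubinValueTwoEllipticUnitsLocalDivisionTwists
import HarnessLib

/-!
# The division twists `𝔞₁(m) = (β^{2^m})`, `𝔞₂(m) = (σβ^{2^m})` for the moduli `𝔣_m = 𝔪 v̄^{m+1}` of de Shalit II.4.14 Step 1
# (`v̄ = v'` the conjugate prime; `σ` complex conjugation): ALL the arithmetic hypotheses of the division step at EVERY modulus

Cell `bsd-print-cf2`, width seat `bsd-line-cf2-p1-w8` g10 (the discharge of the per-modulus division data of
`…EllipticUnitsTwoVariableMeasure.exists_twoVariable_groupDistribution_ellipticUnitsGlobal_of_principal`); `--supports` the banked S3a item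
stmt-BirchSwinnertonDyer-24721 (helper, Theses-free).  THEOREMS ONLY; no named facts.

PRINT (de Shalit II.4.14 Step 1, p. 71): "Fix an auxiliary ideal `𝔞`, `(𝔞, 𝔤p) = 1` … with `𝔣 = 𝔤𝔭̄^m`, `m ≥ 1`, `μ_𝔞 = 12(σ_𝔞 − N𝔞)μ(𝔣)`";
II.4.12 (p. 67–68) / II.4.17 (p. 78): the division by `δ_𝔞` needs `σ_{𝔞₁}` a topological generator of `Gal(K(𝔣𝔭^∞)/K(𝔣𝔭^s))` inside
`1 + 4ℤ₂` and `𝔞₂ = 𝔞̄₁`.  the sibling file's `…LocalDivisionTwists.exists_divisionTwists` produced such a pair for ONE modulus `𝔪` stable under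
`σ` — but the two-variable moduli `𝔣_m = 𝔪 v̄^{m+1}` are NOT `σ`-stable (`σ` swaps `v`, `v̄`).  THIS file produces them for every `m` from
ONE element `x ∈ 𝔪 ∩ v̄^{m+3} ∩ v² ∖ v³` (`exists_mem_mem_pow_mem_sq_not_mem_cube`): with `β = 1 + x`, the twists
`α₁ = β^{2^m}`, `α₂ = σ(α₁)` satisfy `αᵢ ≡ 1 mod 𝔪 v̄^{m+1}`, `α₁ − 1 ∈ v^{m+2} ∖ v^{m+3}` (`2² ∥ β − 1 ⟹ 2^{m+2} ∥ β^{2^m} − 1`,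
`exact_pow_two_pow`), `α₂ − 1 ∈ v^{m+2}`, `α₂ᵏ ≠ α₁ᵏ` (`pow_ne_pow_of_two_adic` for `β, σβ` at the exponent `2^m k`), `N𝔞₁ = N𝔞₂ = N(β)^{2^m} ≥ 2`,
`4 ∣ N𝔞₁ − 1`:

* `exists_mem_mem_pow_mem_sq_not_mem_cube` (`x ∈ 𝔪 ∩ v'^N ∩ v² ∖ v³`), `mem_mul_of_mem_of_mem` (coprime bookkeeping),
  ★★ `exists_divisionTwists_twoVariable` — **the division twists for `𝔣_m = 𝔪 v'^{m+1}` at level `s_m = m + 1`**, ALL the per-modulus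
  hypotheses of `…_of_principal` (with `𝔪` `σ`-stable, `v ∤ 𝔪`, `v' ∤ 𝔪`, `σ(v') ⊆ v`, `σ(v) ⊆ v'`, `𝒪_v ≅ ℤ₂`, `w_𝔪 = 1`, `N(a) = a·σa`).

HONEST FRAMING: elementary 2-adic / ideal bookkeeping over the sibling's lemmas; nothing here closes a crux; BSD is not proved by any of this.

## References
* [deShalit1987] E. de Shalit, *Iwasawa theory of elliptic curves with complex multiplication* (1987), II.4.12 (p. 66–68), II.4.14 Step 1
  (p. 71), II.4.17 (p. 78).
* [NeukirchANT1999] J. Neukirch, *Algebraic Number Theory* (1999), Ch. I §3 (3.1), Ch. II §5.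
-/

-- the summit namespace `Summit.BirchSwinnertonDyer.BirchSwinnertonDyer` repeats the problem name by design (D-0017)
set_option linter.dupNamespace false
set_option autoImplicit false

noncomputable section

open scoped Classical nonZeroDivisors NumberField
open IsDedekindDomain IsDedekindDomain.HeightOneSpectrum Finset
open Literature.NumberTheory.NumberFields
open Summit.BirchSwinnertonDyer.BirchSwinnertonDyer.Theorems.PrintCf2.EllipticUnitsLocal

namespace Summit.BirchSwinnertonDyer.BirchSwinnertonDyer.Theorems.PrintCf2.EllipticUnitsTwoVariable

variable {K : Type} [Field K] [NumberField K] {𝔪 : Ideal (𝓞 K)} {v v' : HeightOneSpectrum (𝓞 K)}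

/-! ## §1. Ideal bookkeeping -/

/-- **The element `x ∈ 𝔪 ∩ v'^N ∩ v² ∖ v³`** (`v ∤ 𝔪`, `v' ≠ v`): a product of `x₁ ∈ 𝔪 ∖ v`, `x₂ ∈ v'^N ∖ v`, `x₃ ∈ v² ∖ v³`
(the sibling's `exists_mem_mem_sq_not_mem_cube` with `3 ↦ N`). [cite: NeukirchANT1999, Ch. I §3 (3.1)] -/
theorem exists_mem_mem_pow_mem_sq_not_mem_cube (hv : ¬ 𝔪 ≤ v.asIdeal) (hv' : v' ≠ v) (N : ℕ) :
    ∃ x : 𝓞 K, x ∈ 𝔪 ∧ x ∈ v'.asIdeal ^ N ∧ x ∈ v.asIdeal ^ 2 ∧ x ∉ v.asIdeal ^ 3 := by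
  obtain ⟨x₁, hx₁𝔪, hx₁v⟩ := Set.not_subset.mp hv
  have hv'N : ¬ v'.asIdeal ^ N ≤ v.asIdeal := fun h ↦ by
    rcases N with _ | N
    · rw [pow_zero, Ideal.one_eq_top, top_le_iff] at h; exact v.isPrime.ne_top h
    · exact hv' (HeightOneSpectrum.ext (v'.isMaximal.eq_of_le v.isPrime.ne_top (v.isPrime.le_of_pow_le h)).symm).symm
  obtain ⟨x₂, hx₂v', hx₂v⟩ := Set.not_subset.mp hv'N
  obtain ⟨x₃, hx₃, hx₃'⟩ := v.asIdeal.exists_mem_pow_notMem_pow_succ v.ne_bot v.isPrime.ne_top 2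
  refine ⟨x₁ * x₂ * x₃, 𝔪.mul_mem_right _ (𝔪.mul_mem_right _ hx₁𝔪),
    Ideal.mul_mem_right _ _ (Ideal.mul_mem_left _ _ hx₂v'), Ideal.mul_mem_left _ _ hx₃, fun h ↦ hx₃' ?_⟩
  rw [← intValuation_le_pow_iff_mem, map_mul, map_mul, intValuation_eq_one_of_not_mem hx₁v,
    intValuation_eq_one_of_not_mem hx₂v, one_mul, one_mul, intValuation_le_pow_iff_mem] at h
  exact h

/-- `I` and a power of a maximal ideal `P ⊉ I` are coprime, so `y ∈ I`, `y ∈ P^n` give `y ∈ I·P^n`. [cite: NeukirchANT1999, Ch. I §3 (3.1)] -/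
theorem mem_mul_of_mem_of_mem {I : Ideal (𝓞 K)} (hI : ¬ I ≤ v'.asIdeal) (n : ℕ) {y : 𝓞 K} (hyI : y ∈ I)
    (hyP : y ∈ v'.asIdeal ^ n) : y ∈ I * v'.asIdeal ^ n := by
  have hsup : I ⊔ v'.asIdeal = ⊤ := by
    refine v'.isMaximal.out.2 _ (lt_of_le_of_ne le_sup_right fun h ↦ hI ?_)
    rw [h]; exact le_sup_left
  have hcop : IsCoprime I (v'.asIdeal ^ n) := (Ideal.isCoprime_iff_sup_eq.mpr hsup).pow_right
  rw [Ideal.mul_eq_inf_of_isCoprime hcop]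
  exact ⟨hyI, hyP⟩

omit [NumberField K] in
/-- `β ≡ 1 mod I ⟹ βⁿ ≡ 1 mod I` (`β − 1 ∣ βⁿ − 1`). [folklore] -/
theorem pow_sub_one_mem {I : Ideal (𝓞 K)} {β : 𝓞 K} (h : β - 1 ∈ I) (n : ℕ) : β ^ n - 1 ∈ I := by
  obtain ⟨c, hc⟩ := sub_dvd_pow_sub_pow β 1 n
  rw [one_pow] at hc
  rw [hc]
  exact I.mul_mem_right c h

/-- Norms of powers of principal ideals: `N((βⁿ)) = N((β))ⁿ`. [folklore] -/
theorem absNorm_span_singleton_pow (β : 𝓞 K) (n : ℕ) :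
    Ideal.absNorm (Ideal.span {β ^ n}) = Ideal.absNorm (Ideal.span {β}) ^ n := by
  rw [← Ideal.span_singleton_pow, map_pow]

/-! ## §2. The division twists for `𝔣_m = 𝔪 v'^{m+1}` -/

variable [NumberField.IsTotallyComplex K]

omit [NumberField.IsTotallyComplex K] in
/-- ★★ **THE DIVISION TWISTS FOR THE TWO-VARIABLE MODULI `𝔣_m = 𝔪 v'^{m+1}`** (de Shalit II.4.14 Step 1: the auxiliary `𝔞` for
`𝔣 = 𝔤𝔭̄^m`).  Let `σ` be an involution of `𝒪_K` preserving `𝔪` with `N(a) = a·σa`, `v' ≠ v` with `σ(v') ⊆ v` AND `σ(v) ⊆ v'` (`v' = v̄`),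
`𝒪_v ≅ ℤ₂`, `v ∤ 𝔪`, `v' ∤ 𝔪`, `w_𝔪 = 1`.  Then for every `m` there are `α₁, α₂ = σα₁ ∈ 𝒪_K`, non-zero, `≡ 1 mod 𝔪 v'^{m+1}`,
`((αᵢ), 𝔪 v'^{m+1} v) = 1`, with `α₁ − 1 ∈ v^{(m+1)+1} ∖ v^{(m+1)+2}`, `α₂ − 1 ∈ v^{(m+1)+1}`, `α₂ᵏ ≠ α₁ᵏ` in `K_v` for all `k > 0`, `N(α₁) ≥ 2`,
`4 ∣ N(α₁) − 1`, `N(α₂) = N(α₁)` — ALL the arithmetic hypotheses at the modulus `𝔣_m` and the level `s_m = m + 1` of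
`…EllipticUnitsTwoVariableMeasure.exists_twoVariable_groupDistribution_ellipticUnitsGlobal_of_principal`
(`α₁ = (1 + x)^{2^m}`, `x ∈ 𝔪 ∩ v'^{m+3} ∩ v² ∖ v³`; `2² ∥ 1 + x − 1 ⟹ 2^{m+2} ∥ α₁ − 1`).
[cite: deShalit1987, II.4.14 Step 1 (p. 71), II.4.12 (p. 66–68), II.4.17 (p. 78)] -/
theorem exists_divisionTwists_twoVariable (hv : ¬ 𝔪 ≤ v.asIdeal) (hv'𝔪 : ¬ 𝔪 ≤ v'.asIdeal)
    (hw : ∀ u : (𝓞 K)ˣ, (u : 𝓞 K) - 1 ∈ 𝔪 → u = 1)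
    (e₂ : v.adicCompletionIntegers K ≃+* ℤ_[2]) (σ : 𝓞 K ≃+* 𝓞 K) (hσσ : ∀ a, σ (σ a) = a) (h𝔪σ : ∀ y ∈ 𝔪, σ y ∈ 𝔪)
    (hv' : v' ≠ v) (hσv' : ∀ y ∈ v'.asIdeal, σ y ∈ v.asIdeal) (hσv : ∀ y ∈ v.asIdeal, σ y ∈ v'.asIdeal)
    (hnorm : ∀ a : 𝓞 K, ((Ideal.absNorm (Ideal.span {a}) : ℕ) : 𝓞 K) = a * σ a) (m : ℕ) :
    ∃ α₁ α₂ : 𝓞 K, α₁ ≠ 0 ∧ α₂ ≠ 0 ∧ α₁ - 1 ∈ 𝔪 * v'.asIdeal ^ (m + 1) ∧ α₂ - 1 ∈ 𝔪 * v'.asIdeal ^ (m + 1) ∧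
      IsCoprime (Ideal.span {α₁}) (𝔪 * v'.asIdeal ^ (m + 1) * v.asIdeal) ∧
      IsCoprime (Ideal.span {α₂}) (𝔪 * v'.asIdeal ^ (m + 1) * v.asIdeal) ∧
      α₁ - 1 ∈ v.asIdeal ^ ((m + 1) + 1) ∧ α₁ - 1 ∉ v.asIdeal ^ ((m + 1) + 2) ∧ α₂ - 1 ∈ v.asIdeal ^ ((m + 1) + 1) ∧
      (∀ k : ℕ, 0 < k → ((α₂ : K) : v.adicCompletion K) ^ k ≠ ((α₁ : K) : v.adicCompletion K) ^ k) ∧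
      2 ≤ Ideal.absNorm (Ideal.span {α₁}) ∧ 4 ∣ Ideal.absNorm (Ideal.span {α₁}) - 1 ∧
      Ideal.absNorm (Ideal.span {α₂}) = Ideal.absNorm (Ideal.span {α₁}) := by
  obtain ⟨x, hx𝔪, hxv', hxv2, hxv3⟩ := exists_mem_mem_pow_mem_sq_not_mem_cube hv hv' (m + 3)
  -- images under `σ`
  have hmapσ : ∀ (I J : Ideal (𝓞 K)), (∀ y ∈ I, σ y ∈ J) → ∀ (n : ℕ) {y : 𝓞 K}, y ∈ I ^ n → σ y ∈ J ^ n := by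
    intro I J hIJ n y hy
    have h1 : Ideal.map σ I ≤ J := Ideal.map_le_iff_le_comap.mpr fun z hz ↦ hIJ z hz
    have h2 := Ideal.mem_map_of_mem (σ : 𝓞 K →+* 𝓞 K) hy
    rw [Ideal.map_pow] at h2
    exact Ideal.pow_right_mono h1 n h2
  have hσx : σ x ∈ v.asIdeal ^ (m + 3) := hmapσ _ _ hσv' _ hxv'
  have hσx3 : σ x ∈ v.asIdeal ^ 3 := Ideal.pow_le_pow_right (by omega) hσx
  have hσx2 : σ x ∈ v.asIdeal ^ 2 := Ideal.pow_le_pow_right (by omega) hσx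
  set β : 𝓞 K := 1 + x with hβ
  have hβ1 : β - 1 = x := by rw [hβ]; ring
  have hσβ : σ β = 1 + σ x := by rw [hβ, map_add, map_one]
  have hσβ1 : σ β - 1 = σ x := by rw [hσβ]; ring
  set α₁ : 𝓞 K := β ^ 2 ^ m with hα₁
  set α₂ : 𝓞 K := σ α₁ with hα₂
  have hα₂' : α₂ = (σ β) ^ 2 ^ m := by rw [hα₂, hα₁, map_pow]
  -- the reading in `ℤ₂`
  set rd : 𝓞 K →+* ℤ_[2] := (e₂ : v.adicCompletionIntegers K →+* ℤ_[2]).comp (algebraMap (𝓞 K) (v.adicCompletionIntegers K))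
    with hrd
  have hrd1 : ∀ (y : 𝓞 K) (n : ℕ), y - 1 ∈ v.asIdeal ^ n ↔ (2 : ℤ_[2]) ^ n ∣ rd y - 1 := by
    intro y n
    rw [← map_one rd, ← map_sub, hrd, ← mem_pow_iff_two_pow_dvd_toPadicInt e₂]
  have hβ2 : (2 : ℤ_[2]) ^ 2 ∣ rd β - 1 := (hrd1 β 2).mp (hβ1 ▸ hxv2)
  have hβ3 : ¬ (2 : ℤ_[2]) ^ 3 ∣ rd β - 1 := fun h ↦ hxv3 (hβ1 ▸ (hrd1 β 3).mpr h)
  have hσβ3 : (2 : ℤ_[2]) ^ 3 ∣ rd (σ β) - 1 := (hrd1 (σ β) 3).mp (hσβ1 ▸ hσx3)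
  -- `2^{m+2} ∥ α₁ − 1`
  obtain ⟨hex1, hex2⟩ := exact_pow_two_pow hβ2 hβ3 m
  have hα₁v : α₁ - 1 ∈ v.asIdeal ^ (m + 1 + 1) := by
    rw [hrd1, hα₁, map_pow, show m + 1 + 1 = 2 + m by omega]; exact hex1
  have hα₁v' : α₁ - 1 ∉ v.asIdeal ^ (m + 1 + 2) := by
    rw [hrd1, hα₁, map_pow, show m + 1 + 2 = 2 + m + 1 by omega]; exact hex2
  -- memberships modulo `𝔪`, `v'^{m+1}`
  have hα₁𝔪 : α₁ - 1 ∈ 𝔪 := pow_sub_one_mem (hβ1 ▸ hx𝔪) _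
  have hα₁P : α₁ - 1 ∈ v'.asIdeal ^ (m + 1) := Ideal.pow_le_pow_right (by omega) (pow_sub_one_mem (hβ1 ▸ hxv') (2 ^ m))
  have hα₂eq : α₂ - 1 = σ (α₁ - 1) := by rw [hα₂, map_sub, map_one]
  have hα₂𝔪 : α₂ - 1 ∈ 𝔪 := by rw [hα₂eq]; exact h𝔪σ _ hα₁𝔪
  have hα₂P : α₂ - 1 ∈ v'.asIdeal ^ (m + 1) := by
    rw [hα₂eq]; exact Ideal.pow_le_pow_right (by omega) (hmapσ _ _ hσv (m + 1 + 1) hα₁v)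
  have hα₂v : α₂ - 1 ∈ v.asIdeal ^ (m + 1 + 1) := by
    rw [hα₂eq]
    exact Ideal.pow_le_pow_right (by omega) (hmapσ _ _ hσv' (m + 3) (pow_sub_one_mem (hβ1 ▸ hxv') (2 ^ m)))
  -- non-vanishing, non-unit
  have hv1 : (1 : 𝓞 K) ∉ v.asIdeal := fun h ↦ v.isPrime.ne_top ((Ideal.eq_top_iff_one _).mpr h)
  have hβ0 : β ≠ 0 := by
    intro h
    have : x = -1 := by rw [hβ] at h; linear_combination h
    exact hv1 (by simpa [this] using (v.asIdeal.neg_mem (Ideal.pow_le_self two_ne_zero hxv2)))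
  have hα₁0 : α₁ ≠ 0 := pow_ne_zero _ hβ0
  have hα₂0 : α₂ ≠ 0 := by rw [hα₂]; exact (map_ne_zero_iff _ σ.injective).mpr hα₁0
  have hNβ0 : Ideal.absNorm (Ideal.span {β}) ≠ 0 := by
    rw [Ne, Ideal.absNorm_eq_zero_iff, Ideal.span_singleton_eq_bot]; exact hβ0
  have hNβ1 : Ideal.absNorm (Ideal.span {β}) ≠ 1 := by
    rw [Ne, Ideal.absNorm_eq_one_iff, Ideal.span_singleton_eq_top]
    intro hu
    have := hw hu.unit (by rw [IsUnit.unit_spec, hβ1]; exact hx𝔪)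
    have hx0 : x = 0 := by
      have h' : (hu.unit : 𝓞 K) = 1 := by rw [this, Units.val_one]
      rw [IsUnit.unit_spec, hβ] at h'; linear_combination h'
    exact hxv3 (by rw [hx0]; exact Submodule.zero_mem _)
  -- the norms
  have hNβ : 2 ≤ Ideal.absNorm (Ideal.span {β}) := by omega
  have hN₁ : Ideal.absNorm (Ideal.span {α₁}) = Ideal.absNorm (Ideal.span {β}) ^ 2 ^ m := absNorm_span_singleton_pow β _
  have hNeq : Ideal.absNorm (Ideal.span {α₂}) = Ideal.absNorm (Ideal.span {α₁}) := by
    have h := hnorm α₂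
    rw [hα₂, hσσ, mul_comm, ← hα₂, ← hnorm α₁] at h
    exact_mod_cast h
  have h4β : (4 : ℤ) ∣ (Ideal.absNorm (Ideal.span {β}) : ℤ) - 1 := by
    apply four_dvd_of_intCast_mem_sq e₂
    have hc : (((Ideal.absNorm (Ideal.span {β}) : ℤ) - 1 : ℤ) : 𝓞 K) = β * σ β - 1 := by
      push_cast; rw [hnorm β]
    rw [hc, show β * σ β - 1 = x + σ x + x * σ x by rw [hσβ, hβ]; ring]
    exact Submodule.add_mem _ (Submodule.add_mem _ hxv2 hσx2) (Ideal.mul_mem_left _ _ hσx2)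
  have h4β' : 4 ∣ Ideal.absNorm (Ideal.span {β}) - 1 := by
    have hN1' : 1 ≤ Ideal.absNorm (Ideal.span {β}) := Nat.one_le_iff_ne_zero.mpr hNβ0
    have h4'' : ((4 : ℕ) : ℤ) ∣ ((Ideal.absNorm (Ideal.span {β}) - 1 : ℕ) : ℤ) := by
      rw [Nat.cast_sub hN1', Nat.cast_one]; exact_mod_cast h4β
    exact Int.natCast_dvd_natCast.mp h4''
  refine ⟨α₁, α₂, hα₁0, hα₂0, mem_mul_of_mem_of_mem hv'𝔪 _ hα₁𝔪 hα₁P, mem_mul_of_mem_of_mem hv'𝔪 _ hα₂𝔪 hα₂P,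
    ((isCoprime_span_singleton_of_sub_one_mem hα₁𝔪).mul_right (isCoprime_span_singleton_of_sub_one_mem hα₁P)).mul_right
      (isCoprime_span_singleton_of_sub_one_mem (Ideal.pow_le_self (by omega) hα₁v)),
    ((isCoprime_span_singleton_of_sub_one_mem hα₂𝔪).mul_right (isCoprime_span_singleton_of_sub_one_mem hα₂P)).mul_right
      (isCoprime_span_singleton_of_sub_one_mem (Ideal.pow_le_self (by omega) hα₂v)),
    hα₁v, hα₁v', hα₂v, fun k hk heq ↦ ?_, ?_, ?_, hNeq⟩
  · -- `α₂ᵏ = α₁ᵏ` in `K_v` ⟹ `rd(σβ)^{2^m k} = rd(β)^{2^m k}`, against `pow_ne_pow_of_two_adic`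
    have hk' := toPadicInt_pow_eq_of_coe_pow_eq e₂ heq
    rw [← hrd, hα₂', hα₁, map_pow, map_pow, ← pow_mul, ← pow_mul] at hk'
    exact pow_ne_pow_of_two_adic hβ2 hβ3 hσβ3 (Nat.mul_pos (Nat.two_pow_pos m) hk) hk'.symm
  · rw [hN₁]; exact le_trans hNβ (Nat.le_self_pow (pow_ne_zero m two_ne_zero) _)
  · rw [hN₁]
    have h := Nat.sub_dvd_pow_sub_pow (Ideal.absNorm (Ideal.span {β})) 1 (2 ^ m)
    rw [one_pow] at h
    exact dvd_trans h4β' h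

end Summit.BirchSwinnertonDyer.BirchSwinnertonDyer.Theorems.PrintCf2.EllipticUnitsTwoVariable

end
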